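import Summits.ABC.Harvest.OpenQuestions
import Literature.NumberTheory.EllipticCurves.SzpiroOfAbcProofs
import Literature.NumberTheory.DiophantineGeometry.FaltingsHeightProofs
import Literature.NumberTheory.DiophantineGeometry.AbcWave0QualityFormProofs
import Summits.ABC.ABC.Theorems.SoloBlindPolyABC
import Literature.Barriers.ABC.NoArithmeticDerivativeSmallDerivativesProofs
import Mathlib.Analysis.SpecialFunctions.Log.Base
import HarnessLib

/-!
# ABC harvest 2015–2026: SORRY-FREE glue / positioning theorems for `OpenQuestions.lean`

`Summits/ABC/Harvest/OpenQuestionsGlue.lean` — cell `abc-harv` (seat typ-1), namespace `Summit.ABC.Harvest`.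
Companion of the statement-only file `OpenQuestions.lean` (see its module docstring and row table): every
«⇒ A0» / «⇒ A-PS» / «below A0» claim of a HARVEST.md row that is marked GLUE = PROVED is a theorem here, with
axioms ⊆ {propext, Classical.choice, Quot.sound}; extra hypotheses are NAMED tree facts only.

* §0 helpers: `szpiro_of_abc : ABC → SzpiroConjecture` (via the discharged `szpiro_of_abcLe_holds`),
  `log_natCast_le_rpow`.
* §1 `SubexponentialSzpiro` / `SzpiroEpsShape`: `⇐ SzpiroConjecture`, `⇐ ABC`, `⇐` any A-PS-shaped bound
  `∃ K C, log|Δ_E| ≤ K log N_E + C` (`subexponentialSzpiro_of_linear` — the A-PS glue, one `exact` away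
  from `Summit.ABC.PolySzpiroRat` when the A1 cell lands it), monotonicity, and the printed record `α = 1`
  from the named fact `MurtyPasten.log_minimalDiscriminant_lt`.
* §2 `HeightConjecture ⟹ (∃ K C, log|Δ_E| ≤ K log N_E + C)` — the A-PS sentence — on the DISCHARGED
  `WeierstrassCurve.log_minimalDiscriminantNorm_lt_faltingsHeight_holds`; hence `⟹ SubexponentialSzpiro`;
  the heavier `ModularDegreeConjecture ⟹ HeightConjecture` (PROVED modulo modularity + Mazur–Kenku) is in
  the sibling `Summits/ABC/Harvest/OpenQuestionsGlueDegree.lean` (400-line cap on files with proofs).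
* §3 `PastenWeakABC ⟺ ∃ κ, PolyABC κ`, `⇐ ABC`, `⟹ SubexpABC`, `⇐ ∃ Λ, GenEll.ABCWithExponent Λ`,
  `⇐ Pasten.SmallDerivativesConjecture` (through the tree's DISCHARGED Lemma 4.1,
  `Pasten.exists_exponent_of_smallDerivatives_holds`).
* §4 `UniformVojtaP1 ⟹ ∃ Λ, ABCWithExponent Λ ⟹ PastenWeakABC` (the tree's `GenEll.abcExp_of_vojtaP1DegWith`).
* §5 `SubexponentialSzpiro ⟹ SzpiroExponentBelowOne`; an A-PS-shaped bound with `K ≥ 0` ⟹ `SzpiroLogLogShape K`.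
* §6 `bernertEtAl2024_thm_1_3 ↔ AbcExceptionalSetExponent (3/5)` (the record is literally the member `3/5`).
* §7 `MoretBaillyCD ⇐` the A-PS sentence (semistable restriction).

HONESTY LINE: abc is not proved by any of this; A-PS is NOT abc — «NOT abc — POLY-SZPIRO(E)»; typed ≠
proved. No `sorry`, no axiom, no new definition.
-/

noncomputable section

namespace Summit.ABC.Harvest

open Literature.NumberTheory.EllipticCurves
open Literature.NumberTheory.DiophantineGeometry
open Literature.Barriers.ABC

/-! ## §0 Helpers -/

/-- `ABC ⟹ Szpiro 6+ε` at the summit's spelling: the `<`/`0 < C` sentence `_root_.ABC` gives the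
Bombieri–Gubler `≤`-form consumed by the discharged fact `szpiro_of_abcLe_holds`
(Silverman AEC VIII.11.5(b); Bombieri–Gubler Thm 12.5.12). [folklore] -/
theorem szpiro_of_abc (hA : _root_.ABC) : SzpiroConjecture :=
  szpiro_of_abcLe_holds fun ε hε => by
    obtain ⟨C, -, hC⟩ := (ABC_iff.mp hA) ε hε
    exact ⟨C, fun a b c habc => (hC a b c habc).le⟩

/-- `log x ≤ x^ε/ε` packaged for a natural number cast to `ℝ`: `log n ≤ (1/ε) · n^ε`. [folklore] -/
theorem log_natCast_le_rpow {n : ℕ} {ε : ℝ} (hε : 0 < ε) :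
    Real.log (n : ℝ) ≤ (1 / ε) * (n : ℝ) ^ ε := by
  have h := Real.log_le_rpow_div (x := (n : ℝ)) (Nat.cast_nonneg n) hε
  simpa [div_eq_inv_mul, one_div] using h

/-! ## §1 `SubexponentialSzpiro` and `SzpiroEpsShape` -/

/-- `SubexponentialSzpiro` is the member `α = 0` of the family. [folklore] -/
theorem subexponentialSzpiro_iff_szpiroEpsShape_zero : SubexponentialSzpiro ↔ SzpiroEpsShape 0 := by
  simp only [SubexponentialSzpiro, SzpiroEpsShape, zero_add]

/-- Monotonicity of the family in the exponent (`N_E ≥ 1`; the constant becomes `max C 0`). [folklore] -/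
theorem szpiroEpsShape_mono {α β : ℝ} (hle : α ≤ β) (h : SzpiroEpsShape α) : SzpiroEpsShape β := by
  intro ε hε
  obtain ⟨C, hC⟩ := h ε hε
  refine ⟨max C 0, fun W _ => ?_⟩
  have hN : (1 : ℝ) ≤ (W.conductorNorm ℤ : ℝ) := by
    exact_mod_cast WeierstrassCurve.conductorNorm_pos_holds W
  calc Real.log (W.minimalDiscriminantNorm ℤ : ℝ) ≤ C * (W.conductorNorm ℤ : ℝ) ^ (α + ε) := hC W
    _ ≤ max C 0 * (W.conductorNorm ℤ : ℝ) ^ (α + ε) :=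
        mul_le_mul_of_nonneg_right (le_max_left C 0) (Real.rpow_nonneg (by linarith) _)
    _ ≤ max C 0 * (W.conductorNorm ℤ : ℝ) ^ (β + ε) :=
        mul_le_mul_of_nonneg_left (Real.rpow_le_rpow_of_exponent_le hN (by linarith)) (le_max_right C 0)

/-- **A-PS glue: any linear-in-`log N_E` bound ⟹ sub-exponential Szpiro.** If
`log|Δ_E| ≤ K log N_E + C` for all `E/ℚ` (the A-PS sentence «NOT abc — POLY-SZPIRO(K)» spelled out as a
hypothesis; `Summit.ABC.PolySzpiroRat` once it lands), then `SubexponentialSzpiro`: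
`K log N + C ≤ (|K|/ε + |C|) · N^ε`. [folklore] -/
theorem subexponentialSzpiro_of_linear
    (h : ∃ K C : ℝ, ∀ (W : WeierstrassCurve ℚ) [W.IsElliptic],
      Real.log (W.minimalDiscriminantNorm ℤ : ℝ) ≤ K * Real.log (W.conductorNorm ℤ : ℝ) + C) :
    SubexponentialSzpiro := by
  obtain ⟨K, C, hKC⟩ := h
  intro ε hε
  refine ⟨|K| * (1 / ε) + |C|, fun W _ => ?_⟩
  have hN : (1 : ℝ) ≤ (W.conductorNorm ℤ : ℝ) := by
    exact_mod_cast WeierstrassCurve.conductorNorm_pos_holds W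
  have hlogN : Real.log (W.conductorNorm ℤ : ℝ) ≤ (1 / ε) * (W.conductorNorm ℤ : ℝ) ^ ε :=
    log_natCast_le_rpow hε
  have hlog0 : 0 ≤ Real.log (W.conductorNorm ℤ : ℝ) := Real.log_nonneg hN
  have hNε : (1 : ℝ) ≤ (W.conductorNorm ℤ : ℝ) ^ ε := Real.one_le_rpow hN hε.le
  have h1 := hKC W
  have hK : K * Real.log (W.conductorNorm ℤ : ℝ) ≤ |K| * Real.log (W.conductorNorm ℤ : ℝ) :=
    mul_le_mul_of_nonneg_right (le_abs_self K) hlog0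
  have hC : C ≤ |C| * (W.conductorNorm ℤ : ℝ) ^ ε :=
    (le_abs_self C).trans (le_mul_of_one_le_right (abs_nonneg C) hNε)
  have hK' : |K| * Real.log (W.conductorNorm ℤ : ℝ) ≤ |K| * ((1 / ε) * (W.conductorNorm ℤ : ℝ) ^ ε) :=
    mul_le_mul_of_nonneg_left hlogN (abs_nonneg K)
  calc Real.log (W.minimalDiscriminantNorm ℤ : ℝ)
      ≤ K * Real.log (W.conductorNorm ℤ : ℝ) + C := h1
    _ ≤ |K| * ((1 / ε) * (W.conductorNorm ℤ : ℝ) ^ ε) + |C| * (W.conductorNorm ℤ : ℝ) ^ ε := by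
        linarith
    _ = (|K| * (1 / ε) + |C|) * (W.conductorNorm ℤ : ℝ) ^ ε := by ring

/-- **Positioning: Szpiro `6+ε` ⟹ sub-exponential Szpiro.** From `|Δ_E| ≤ C · N_E^7` (Szpiro at `ε = 1`):
`log|Δ_E| ≤ log(max C 1) + 7 log N_E`, a linear bound. [folklore] -/
theorem subexponentialSzpiro_of_szpiro (hS : SzpiroConjecture) : SubexponentialSzpiro := by
  refine subexponentialSzpiro_of_linear ?_
  obtain ⟨C, hC⟩ := hS 1 one_pos
  refine ⟨6 + 1, Real.log (max C 1), fun W _ => ?_⟩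
  have hN : (1 : ℝ) ≤ (W.conductorNorm ℤ : ℝ) := by
    exact_mod_cast WeierstrassCurve.conductorNorm_pos_holds W
  have hN0 : (0 : ℝ) < (W.conductorNorm ℤ : ℝ) := by linarith
  have hΔ' : (W.minimalDiscriminantNorm ℤ : ℝ) ≤ max C 1 * (W.conductorNorm ℤ : ℝ) ^ (6 + 1 : ℝ) :=
    (hC W).trans (mul_le_mul_of_nonneg_right (le_max_left C 1) (Real.rpow_nonneg hN0.le _))
  have hM : (0 : ℝ) < max C 1 := lt_of_lt_of_le one_pos (le_max_right C 1)
  rcases Nat.eq_zero_or_pos (W.minimalDiscriminantNorm ℤ) with h0 | hpos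
  · simp only [h0, Nat.cast_zero, Real.log_zero]
    have := Real.log_nonneg hN
    have : 0 ≤ Real.log (max C 1) := Real.log_nonneg (le_max_right C 1)
    nlinarith
  · have hΔ0 : (0 : ℝ) < (W.minimalDiscriminantNorm ℤ : ℝ) := by exact_mod_cast hpos
    calc Real.log (W.minimalDiscriminantNorm ℤ : ℝ)
        ≤ Real.log (max C 1 * (W.conductorNorm ℤ : ℝ) ^ (6 + 1 : ℝ)) := Real.log_le_log hΔ0 hΔ'
      _ = Real.log (max C 1) + (6 + 1 : ℝ) * Real.log (W.conductorNorm ℤ : ℝ) := by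
          rw [Real.log_mul hM.ne' (Real.rpow_pos_of_pos hN0 _).ne', Real.log_rpow hN0]
      _ = (6 + 1) * Real.log (W.conductorNorm ℤ : ℝ) + Real.log (max C 1) := by ring

/-- **Positioning: the summit ⟹ sub-exponential Szpiro**; the row sits BELOW rung A0 and admits no
refutation short of `¬ABC`. [folklore] -/
theorem subexponentialSzpiro_of_abc (hA : _root_.ABC) : SubexponentialSzpiro :=
  subexponentialSzpiro_of_szpiro (szpiro_of_abc hA)

/-- **Positioning: the printed record `α = 1`** — Murty–Pasten 2013 Thm 7.1
(`log|Δ_E| < 1.2 N log N + 93`, named fact `MurtyPasten.log_minimalDiscriminant_lt`, taken as a hypothesis)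
gives `SzpiroEpsShape 1`: `1.2 N log N + 93 ≤ (1.2/ε + 93) · N^{1+ε}`.
[cite: MurtyPasten2013, Thm 7.1 (p. 3751)] -/
theorem szpiroEpsShape_one_of_murtyPasten (h : MurtyPasten.log_minimalDiscriminant_lt) :
    SzpiroEpsShape 1 := by
  intro ε hε
  refine ⟨1.2 * (1 / ε) + 93, fun W _ => ?_⟩
  have hN : (1 : ℝ) ≤ (W.conductorNorm ℤ : ℝ) := by
    exact_mod_cast WeierstrassCurve.conductorNorm_pos_holds W
  have hN0 : (0 : ℝ) < (W.conductorNorm ℤ : ℝ) := by linarith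
  have hlt := h W
  have hlogN : Real.log (W.conductorNorm ℤ : ℝ) ≤ (1 / ε) * (W.conductorNorm ℤ : ℝ) ^ ε :=
    log_natCast_le_rpow hε
  have hsplit : (W.conductorNorm ℤ : ℝ) ^ (1 + ε) =
      (W.conductorNorm ℤ : ℝ) * (W.conductorNorm ℤ : ℝ) ^ ε := by
    rw [Real.rpow_add hN0, Real.rpow_one]
  have hNε : (1 : ℝ) ≤ (W.conductorNorm ℤ : ℝ) ^ ε := Real.one_le_rpow hN hε.le
  have h1e : (1 : ℝ) ≤ (W.conductorNorm ℤ : ℝ) ^ (1 + ε) := Real.one_le_rpow hN (by linarith)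
  rw [hsplit] at h1e ⊢
  nlinarith [hlt, hlogN, mul_le_mul_of_nonneg_left hlogN (by linarith : (0:ℝ) ≤ 1.2 * (W.conductorNorm ℤ : ℝ)),
    Real.log_nonneg hN]

/-! ## §2 The Height conjecture reaches the A-PS sentence -/

/-- **GLUE (PROVED): Height conjecture ⟹ the A-PS sentence** `∃ K' C', ∀ E/ℚ, log|Δ_E| ≤ K' log N_E + C'`
(`K' = 12K`, `C' = 12C + 16`), by the DISCHARGED Silverman–Pasten inequality
`WeierstrassCurve.log_minimalDiscriminantNorm_lt_faltingsHeight_holds` (`log|Δ_min| < 12 h_F + 16`, Pasten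
2024 Lemma 18.1): "The height conjecture implies Szpiro's conjecture because `log|Δ_E| ≪ h(E)`"
(Cuevas Barrientos–Pasten §1.2). The conclusion is the body of rung A-PS; the one-line repackaging into
`Summit.ABC.PolySzpiroRat` is appended when that decl lands. «NOT abc — POLY-SZPIRO(12K)».
[cite: CuevasPasten2025SubexpSzpiro, §1.2] [cite: PastenShimura2024, Lemma 18.1] -/
theorem exists_log_minimalDiscriminant_le_of_heightConjecture (h : HeightConjecture) :
    ∃ K C : ℝ, ∀ (W : WeierstrassCurve ℚ) [W.IsElliptic],
      Real.log (W.minimalDiscriminantNorm ℤ : ℝ) ≤ K * Real.log (W.conductorNorm ℤ : ℝ) + C := by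
  obtain ⟨K, C, hK⟩ := h
  refine ⟨12 * K, 12 * C + 16, fun W _ => ?_⟩
  have h1 := hK W
  have h2 := WeierstrassCurve.log_minimalDiscriminantNorm_lt_faltingsHeight_holds W
  rw [WeierstrassCurve.minimalDiscriminantNorm_ringOfIntegers_rat_holds W, Module.finrank_self,
    Nat.cast_one, inv_one, one_mul] at h2
  linarith

/-- **Positioning (PROVED): Height conjecture ⟹ sub-exponential Szpiro** (through the A-PS sentence).
[folklore] -/
theorem subexponentialSzpiro_of_heightConjecture (h : HeightConjecture) : SubexponentialSzpiro :=
  subexponentialSzpiro_of_linear (exists_log_minimalDiscriminant_le_of_heightConjecture h)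

/-! ## §3 `PastenWeakABC` ⟺ `∃ κ, PolyABC κ`, below A0, above `SubexpABC` -/

/-- **Positioning (PROVED): Conj. 1.2 ⟹ a polynomial abc inequality** `c ≤ 1 · rad(abc)^κ`
(`c ≤ abc` for an abc triple). [folklore] -/
theorem exists_polyABC_of_pastenWeakABC (h : PastenWeakABC) :
    ∃ κ : ℝ, Summit.ABC.ABC.Theorems.PolyABC κ := by
  obtain ⟨κ, -, hκ⟩ := h
  refine ⟨κ, 1, one_pos, fun a b c habc => ?_⟩
  have hlt := hκ a b c habc
  obtain ⟨ha, hb, -, -⟩ := habc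
  have hc : (c : ℝ) ≤ ((a * b * c : ℕ) : ℝ) := by
    exact_mod_cast Nat.le_mul_of_pos_left c (Nat.mul_pos ha hb)
  linarith

/-- **Positioning (PROVED): a polynomial abc inequality ⟹ Conj. 1.2.** From `c ≤ C · rad^K`:
`abc ≤ c³ ≤ C³ rad^{3K} < 2^m rad^{3K} ≤ rad^{3K+m}` with `m = max 1 (log₂ C³ + 1)`, using `rad(abc) ≥ 2`
(`IsABCTriple.two_le_rad`). [folklore] -/
theorem pastenWeakABC_of_polyABC {K : ℝ} (h : Summit.ABC.ABC.Theorems.PolyABC K) : PastenWeakABC := by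
  have hK : 0 < K := Summit.ABC.ABC.Theorems.polyABC_pos h
  obtain ⟨C, hC, hCK⟩ := h
  set m : ℝ := max 1 (Real.logb 2 (C ^ 3) + 1) with hm
  have hm0 : 0 ≤ m := le_trans zero_le_one (le_max_left _ _)
  refine ⟨3 * K + m, by positivity, fun a b c habc => ?_⟩
  have hle := hCK a b c habc
  have hR2 : (2 : ℝ) ≤ ((rad a b c : ℕ) : ℝ) := by exact_mod_cast habc.two_le_rad
  have hR0 : (0 : ℝ) < ((rad a b c : ℕ) : ℝ) := by linarith
  obtain ⟨ha, hb, hab, -⟩ := habc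
  -- `abc ≤ c³`
  have habc_le : ((a * b * c : ℕ) : ℝ) ≤ (c : ℝ) ^ 3 := by
    have ha' : a ≤ c := by omega
    have hb' : b ≤ c := by omega
    exact_mod_cast (show a * b * c ≤ c ^ 3 by
      calc a * b * c ≤ c * c * c := by gcongr
        _ = c ^ 3 := by ring)
  -- `c³ ≤ C³ rad^{3K}`
  have hc0 : (0 : ℝ) ≤ (c : ℝ) := Nat.cast_nonneg c
  have hc3 : (c : ℝ) ^ 3 ≤ (C * ((rad a b c : ℕ) : ℝ) ^ K) ^ 3 :=
    pow_le_pow_left₀ hc0 hle 3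
  have hpow : (C * ((rad a b c : ℕ) : ℝ) ^ K) ^ 3 = C ^ 3 * ((rad a b c : ℕ) : ℝ) ^ (3 * K) := by
    rw [mul_pow, ← Real.rpow_natCast (((rad a b c : ℕ) : ℝ) ^ K) 3, ← Real.rpow_mul hR0.le]
    norm_num [mul_comm K 3]
  -- `C³ < 2^m ≤ rad^m`
  have hC3 : (0 : ℝ) < C ^ 3 := pow_pos hC 3
  have h2m : C ^ 3 < (2 : ℝ) ^ m := by
    have h1 : (2 : ℝ) ^ (Real.logb 2 (C ^ 3) + 1) = C ^ 3 * 2 := by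
      rw [Real.rpow_add two_pos, Real.rpow_logb two_pos (by norm_num) hC3, Real.rpow_one]
    have h2 : (2 : ℝ) ^ (Real.logb 2 (C ^ 3) + 1) ≤ (2 : ℝ) ^ m :=
      Real.rpow_le_rpow_of_exponent_le one_le_two (le_max_right _ _)
    nlinarith
  have hRm : (2 : ℝ) ^ m ≤ ((rad a b c : ℕ) : ℝ) ^ m := Real.rpow_le_rpow zero_le_two hR2 hm0
  have hR3K : (0 : ℝ) < ((rad a b c : ℕ) : ℝ) ^ (3 * K) := Real.rpow_pos_of_pos hR0 _
  calc ((a * b * c : ℕ) : ℝ) ≤ C ^ 3 * ((rad a b c : ℕ) : ℝ) ^ (3 * K) := by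
        rw [← hpow]; exact habc_le.trans hc3
    _ < ((rad a b c : ℕ) : ℝ) ^ m * ((rad a b c : ℕ) : ℝ) ^ (3 * K) := by
        exact mul_lt_mul_of_pos_right (h2m.trans_le hRm) hR3K
    _ = ((rad a b c : ℕ) : ℝ) ^ (3 * K + m) := by
        rw [← Real.rpow_add hR0]; ring_nf

/-- **Positioning (PROVED): the summit ⟹ Conj. 1.2** (`polyABC_of_abc` at `K = 2`, then
`pastenWeakABC_of_polyABC`); Conj. 1.2 sits BELOW rung A0. [folklore] -/
theorem pastenWeakABC_of_abc (hA : _root_.ABC) : PastenWeakABC :=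
  pastenWeakABC_of_polyABC (Summit.ABC.ABC.Theorems.polyABC_of_abc hA (K := 2) one_lt_two)

/-- **Positioning (PROVED): Conj. 1.2 ⟹ sub-exponential abc** `log c ≪_ε rad(abc)^ε`
(`Summit.ABC.ABC.Theorems.SubexpABC`, via `subexpABC_of_polyABC`). [folklore] -/
theorem subexpABC_of_pastenWeakABC (h : PastenWeakABC) : Summit.ABC.ABC.Theorems.SubexpABC := by
  obtain ⟨κ, hκ⟩ := exists_polyABC_of_pastenWeakABC h
  exact Summit.ABC.ABC.Theorems.subexpABC_of_polyABC hκ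

/-- **Positioning (PROVED): abc with SOME exponent `Λ` ([GenEll] `ABCWithExponent Λ`) ⟹ Conj. 1.2**
(at `ε = 1`: `c < C rad^{2Λ}`, a `PolyABC (Λ·2)`). [folklore] -/
theorem pastenWeakABC_of_abcWithExponent (h : ∃ Λ : ℝ, GenEll.ABCWithExponent Λ) : PastenWeakABC := by
  obtain ⟨Λ, hΛ⟩ := h
  obtain ⟨C, hC, H⟩ := hΛ 1 one_pos
  exact pastenWeakABC_of_polyABC (K := Λ * (1 + 1)) ⟨C, hC, fun a b c habc => (H a b c habc).le⟩

/-- **Positioning (PROVED): Pasten's Small Derivatives Conjecture (CMB 65 (2022) Conj. 3.9, tree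
`Literature.Barriers.ABC.Pasten.SmallDerivativesConjecture`, row H-102) ⟹ Conj. 1.2**, through the tree's
DISCHARGED Lemma 4.1 / Cor. 4.6 `Pasten.exists_exponent_of_smallDerivatives_holds` (`⟹ ∃ M, c < rad(abc)^M`)
and `pastenWeakABC_of_polyABC`. So the small-derivatives door is a POLY-ABC door («NOT abc; NOT known ⇒
A-PS», REF-B P-6). [cite: Pasten2021, Lemma 4.1 and Cor. 4.6] -/
theorem pastenWeakABC_of_smallDerivatives (h : Literature.Barriers.ABC.Pasten.SmallDerivativesConjecture) :
    PastenWeakABC := by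
  obtain ⟨M, hM⟩ := Literature.Barriers.ABC.Pasten.exists_exponent_of_smallDerivatives_holds h
  exact pastenWeakABC_of_polyABC (K := M) ⟨1, one_pos, fun a b c habc => by
    simpa using (hM a b c habc).le⟩

/-! ## §4 The effective-Mordell calibration reaches poly-abc -/

/-- **GLUE (PROVED): uniform Vojta on `ℙ¹ ∖ {0,1,∞}` with coefficient `Λ` ⟹ abc with exponent `Λ`**
(the `d = 1` case; the tree's `GenEll.abcExp_of_vojtaP1DegWith`). [cite: MochizukiGenEll2010, Thm 2.1 (i)] -/
theorem exists_abcWithExponent_of_uniformVojtaP1 (h : UniformVojtaP1) :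
    ∃ Λ : ℝ, GenEll.ABCWithExponent Λ := by
  obtain ⟨Λ, hΛ⟩ := h
  exact ⟨Λ, GenEll.abcExp_of_vojtaP1DegWith hΛ⟩

/-- **Positioning (PROVED): the calibration row H-206 is a POLY-ABC door** (`⟹ PastenWeakABC`). [folklore] -/
theorem pastenWeakABC_of_uniformVojtaP1 (h : UniformVojtaP1) : PastenWeakABC :=
  pastenWeakABC_of_abcWithExponent (exists_abcWithExponent_of_uniformVojtaP1 h)

/-! ## §5 Record rungs -/

/-- **Positioning (PROVED): sub-exponential Szpiro ⟹ some exponent `α < 1`** (`α = 0`). [folklore] -/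
theorem szpiroExponentBelowOne_of_subexponential (h : SubexponentialSzpiro) : SzpiroExponentBelowOne :=
  ⟨0, zero_lt_one, subexponentialSzpiro_iff_szpiroEpsShape_zero.mp h⟩

/-- **Positioning (PROVED): an A-PS-shaped bound with exponent `K ≥ 0` ⟹ Pasten's yardstick
`SzpiroLogLogShape K`** (REF-B v2 ask (ii)): for `N_E ≥ 3` one has `log N_E > 1`; if `log log N_E ≥ 1`
then `K log N ≤ K log N · log log N`, else `log N_E < e` and `K log N ≤ K e`; so `C' = C + K e` works.
[folklore] -/
theorem szpiroLogLogShape_of_linear {K C : ℝ} (hK : 0 ≤ K)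
    (h : ∀ (W : WeierstrassCurve ℚ) [W.IsElliptic],
      Real.log (W.minimalDiscriminantNorm ℤ : ℝ) ≤ K * Real.log (W.conductorNorm ℤ : ℝ) + C) :
    SzpiroLogLogShape K := by
  refine ⟨C + K * Real.exp 1, fun W _ hN3 => ?_⟩
  have h1 := h W
  have hN : (3 : ℝ) ≤ (W.conductorNorm ℤ : ℝ) := by exact_mod_cast hN3
  have hL1 : 1 < Real.log (W.conductorNorm ℤ : ℝ) := by
    rw [Real.lt_log_iff_exp_lt (by linarith)]
    have := Real.exp_one_lt_d9
    linarith
  have hL0 : 0 < Real.log (W.conductorNorm ℤ : ℝ) := by linarith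
  have hLL0 : 0 < Real.log (Real.log (W.conductorNorm ℤ : ℝ)) := Real.log_pos hL1
  have hKL : 0 ≤ K * Real.log (W.conductorNorm ℤ : ℝ) := mul_nonneg hK hL0.le
  by_cases hcase : 1 ≤ Real.log (Real.log (W.conductorNorm ℤ : ℝ))
  · have h2 : K * Real.log (W.conductorNorm ℤ : ℝ) * 1 ≤
        K * Real.log (W.conductorNorm ℤ : ℝ) * Real.log (Real.log (W.conductorNorm ℤ : ℝ)) :=
      mul_le_mul_of_nonneg_left hcase hKL
    have hKe : 0 ≤ K * Real.exp 1 := mul_nonneg hK (Real.exp_pos 1).le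
    linarith
  · have hlt : Real.log (Real.log (W.conductorNorm ℤ : ℝ)) < 1 := not_le.mp hcase
    have hLe : Real.log (W.conductorNorm ℤ : ℝ) < Real.exp 1 :=
      (Real.log_lt_iff_lt_exp hL0).mp hlt
    have h2 : K * Real.log (W.conductorNorm ℤ : ℝ) ≤ K * Real.exp 1 :=
      mul_le_mul_of_nonneg_left hLe.le hK
    have h3 : 0 ≤ K * Real.log (W.conductorNorm ℤ : ℝ) * Real.log (Real.log (W.conductorNorm ℤ : ℝ)) :=
      mul_nonneg hKL hLL0.le
    linarith

/-! ## §6 The exceptional-set record is the member `θ = 3/5` -/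

/-- **Positioning (PROVED): Bernert–Browning–Lichtman–Teräväinen Thm 1.3 is, literally,
`AbcExceptionalSetExponent (3/5)`.** [cite: BernertEtAl2024, Thm. 1.3 (arXiv v2)] -/
theorem abcExceptionalSetExponent_three_fifths_iff :
    bernertEtAl2024_thm_1_3 ↔ AbcExceptionalSetExponent (3 / 5) := Iff.rfl

/-! ## §7 Moret-Bailly's CD is the semistable half of the A-PS sentence -/

/-- **Positioning (PROVED): the A-PS sentence ⟹ Hypothèse CD** (restriction to semistable curves;
`Summit.ABC.PolySzpiroRat ⟹ MoretBaillyCD` once the A1 cell's decl lands). [folklore] -/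
theorem moretBaillyCD_of_linear
    (h : ∃ K C : ℝ, ∀ (W : WeierstrassCurve ℚ) [W.IsElliptic],
      Real.log (W.minimalDiscriminantNorm ℤ : ℝ) ≤ K * Real.log (W.conductorNorm ℤ : ℝ) + C) :
    MoretBaillyCD := by
  obtain ⟨K, C, hKC⟩ := h
  exact ⟨K, C, fun W _ _ => hKC W⟩

/-- **Positioning (PROVED): the Height conjecture ⟹ Hypothèse CD** (through the A-PS sentence). [folklore] -/
theorem moretBaillyCD_of_heightConjecture (h : HeightConjecture) : MoretBaillyCD :=
  moretBaillyCD_of_linear (exists_log_minimalDiscriminant_le_of_heightConjecture h)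

end Summit.ABC.Harvest
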